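import Summits.KontsevichZagierPeriods.KontsevichZagierPeriods.Theorems.RootDecompRationalCubeDichotomyRankDescentP17

/-! # `RootDecompRationalCubeDichotomyRankDescentP18` — part 4/9 of the mechanical ≤400-line split of `RankDescent_delta_v12_to_v14h_P15plus.lean` (sha256 311877f354eea7b0…)
Source: decomp-kz lens-2 g15 RankDescent_delta_v12_to_v14h_P15plus.lean @311877f3 (critic CLEARED g7-6 l.1400: 26322 ⟺ LetterDegenerateKernel, GenericKernel THEOREM); --supports stmt-KontsevichZagierPeriods-26322.
Split by census-1 g10 `gen/splitlean.py`: scopes re-opened with their `open`/`variable`/`set_option` context; mathematics and declaration order unchanged. -/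

noncomputable section
open MeasureTheory Set MvPolynomial
open Literature.NumberTheory.Transcendental
open Literature.NumberTheory.Transcendental.KZ
namespace Summit.KontsevichZagierPeriods.RootDecompRationalCubeDichotomy.Rung26322.RankDescent
variable {M : ℕ}
open MeasureTheory Set MvPolynomial in
open Literature.NumberTheory.Transcendental in
open Literature.NumberTheory.Transcendental.KZ in
open MeasureTheory Set MvPolynomial in
open Literature.NumberTheory.Transcendental in
open Literature.NumberTheory.Transcendental.KZ in
/-- Soundness: congruent formal combinations have equal values. (cite KontsevichZagier2001, §1.2) -/
private theorem eval_eq_of_sub_mem {x y : FormalRep} (h : x - y ∈ relations) : eval x = eval y := by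
  have h' := relations_le_ker_eval_holds h
  rw [AddMonoidHom.mem_ker, map_sub] at h'
  exact sub_eq_zero.1 h'

section LetterCriterion
variable {k : ℕ}

/-- The face of the `s = 0` potential `G_j/Q` along `x_j = c` IS the clean face, as a function. [folklore] -/
theorem fn_faceAt_Wp_zero (T : RFun (k + 1)) (Gj : MvPolynomial (Fin (k + 1)) ℚ) (j : Fin (k + 1)) (c : ℚ)
    (hc : 0 ≤ c ∧ c ≤ 1) (x : Fin k → ℝ) :
    ((Wp T 0 Gj).faceAt j c hc).fn x = (cface T.den T.den_ne Gj j c hc).fn x := by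
  rw [RFun.fn_faceAt, RFun.fn_apply, fn_cface]
  show aeval (Fin.insertNth j (c : ℝ) x) Gj / aeval (Fin.insertNth j (c : ℝ) x) (T.den ^ (0 + 1)) = _
  rw [zero_add, pow_one]

/-- The `2(k+1)` SIGNED FACES of the exact descent of `T` with potentials `G`:
`(j, true) ↦ [G_j|_{x_j=1}/Q|_{x_j=1}]`, `(j, false) ↦ [−G_j|_{x_j=0}/Q|_{x_j=0}]`. (folklore) -/
def faceFam (T : RFun (k + 1)) (G : Fin (k + 1) → MvPolynomial (Fin (k + 1)) ℚ) :
    Fin (k + 1) × Bool → RFun k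
  | (j, true) => cface T.den T.den_ne (G j) j 1 zero_le_one_and
  | (j, false) => (cface T.den T.den_ne (G j) j 0 le_rfl_and).neg

/-- Every member of the face family has a FACE of `Q` as denominator. [folklore] -/
theorem faceFam_den (T : RFun (k + 1)) (G : Fin (k + 1) → MvPolynomial (Fin (k + 1)) ℚ)
    (p : Fin (k + 1) × Bool) :
    ∃ c : ℚ, (c = 0 ∨ c = 1) ∧ (faceFam T G p).den = bind₁ (insX p.1 c) T.den := by
  rcases p with ⟨j, _ | _⟩
  · exact ⟨0, Or.inl rfl, rfl⟩
  · exact ⟨1, Or.inr rfl, rfl⟩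

/-- **Exact numerators descend FORMALLY to the signed face family** (§5 with `s = 0`, faces cleaned):
`P·Q = Σ_j (∂_j G_j · Q − G_j ∂_j Q) ⟹ [P/Q] − Σ_{(j,±)} [faceFam (j,±)] ∈ relations`.
(cite KontsevichZagier2001, §1.2 rules (1),(3)) -/
theorem exact_rel_faceFam (T : RFun (k + 1)) (G : Fin (k + 1) → MvPolynomial (Fin (k + 1)) ℚ)
    (hG : T.num * T.den = ∑ j, exS T.den j (G j)) :
    KZ.of T.rep - ∑ p, KZ.of (faceFam T G p).rep ∈ KZ.relations := by
  have hid : T.num * T.den ^ (0 + 1) =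
      ∑ j, (pderiv j (G j) * T.den - C (((0 : ℕ) : ℚ) + 1) * (G j * pderiv j T.den)) := by
    rw [sum_exS_eq, ← hG, zero_add, pow_one]
  have h1 := descent_rel_exact T 0 G hid
  have h2 : ∑ j, ((KZ.of ((Wp T 0 (G j)).faceAt j 1 zero_le_one_and).rep
      - KZ.of (cface T.den T.den_ne (G j) j 1 zero_le_one_and).rep)
      - (KZ.of ((Wp T 0 (G j)).faceAt j 0 le_rfl_and).rep
        - KZ.of (cface T.den T.den_ne (G j) j 0 le_rfl_and).rep)) ∈ KZ.relations :=
    sum_mem fun j _ => sub_mem (RFun.rel_of_eqOn fun x _ => fn_faceAt_Wp_zero T (G j) j 1 _ x)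
      (RFun.rel_of_eqOn fun x _ => fn_faceAt_Wp_zero T (G j) j 0 _ x)
  have h3 : ∑ j, (KZ.of (cface T.den T.den_ne (G j) j 0 le_rfl_and).neg.rep
      + KZ.of (cface T.den T.den_ne (G j) j 0 le_rfl_and).rep) ∈ KZ.relations :=
    sum_mem fun j _ => RFun.rel_neg _
  have hsum : ∑ p, KZ.of (faceFam T G p).rep
      = ∑ j, (KZ.of (cface T.den T.den_ne (G j) j 1 zero_le_one_and).rep
        + KZ.of (cface T.den T.den_ne (G j) j 0 le_rfl_and).neg.rep) := by
    rw [Fintype.sum_prod_type]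
    refine Finset.sum_congr rfl fun j _ => ?_
    rw [Fintype.sum_bool]
    rfl
  rw [hsum]
  have heq : KZ.of T.rep - ∑ j, (KZ.of (cface T.den T.den_ne (G j) j 1 zero_le_one_and).rep
      + KZ.of (cface T.den T.den_ne (G j) j 0 le_rfl_and).neg.rep)
      = (KZ.of T.rep - ∑ j, (KZ.of ((Wp T 0 (G j)).faceAt j 1 zero_le_one_and).rep
          - KZ.of ((Wp T 0 (G j)).faceAt j 0 le_rfl_and).rep))
        + ∑ j, ((KZ.of ((Wp T 0 (G j)).faceAt j 1 zero_le_one_and).rep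
            - KZ.of (cface T.den T.den_ne (G j) j 1 zero_le_one_and).rep)
          - (KZ.of ((Wp T 0 (G j)).faceAt j 0 le_rfl_and).rep
            - KZ.of (cface T.den T.den_ne (G j) j 0 le_rfl_and).rep))
        - ∑ j, (KZ.of (cface T.den T.den_ne (G j) j 0 le_rfl_and).neg.rep
            + KZ.of (cface T.den T.den_ne (G j) j 0 le_rfl_and).rep) := by
    simp only [Finset.sum_add_distrib, Finset.sum_sub_distrib]; abel
  rw [heq]
  exact sub_mem (add_mem h1 h2) h3

/-! ### Denominator systems, the lower span, genericity -/

/-- A DENOMINATOR SYSTEM `D` (one set of polynomials per dimension) is ZERO-FREE: no member vanishes on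
the closed cube of its dimension. (folklore) -/
def ZeroFree (D : (k : ℕ) → Set (MvPolynomial (Fin k) ℚ)) : Prop :=
  ∀ (k : ℕ) (F : MvPolynomial (Fin k) ℚ), F ∈ D k → ∀ x ∈ KZ.cube k, aeval x F ≠ 0

/-- `D` is FACE-CLOSED: with `F` of dimension `k+1` it contains the `2(k+1)` faces `F|_{x_j := 0, 1}`
(variables re-indexed along `j.succAbove`). (folklore) -/
def FaceClosed (D : (k : ℕ) → Set (MvPolynomial (Fin k) ℚ)) : Prop :=
  ∀ (k : ℕ) (F : MvPolynomial (Fin (k + 1)) ℚ), F ∈ D (k + 1) →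
    ∀ (j : Fin (k + 1)) (c : ℚ), c = 0 ∨ c = 1 → bind₁ (insX j c) F ∈ D k

/-- THE LOWER SPAN `VSpan D k`: the `ℚ`-span in `ℝ` of ALL the values `∫_{[0,1]^j} P/F`, `j ≤ k`,
`F ∈ D j`, `P ∈ ℚ[x]` arbitrary. (folklore) -/
def VSpan (D : (k : ℕ) → Set (MvPolynomial (Fin k) ℚ)) (k : ℕ) : Submodule ℚ ℝ :=
  Submodule.span ℚ {v : ℝ | ∃ (j : ℕ) (P F : MvPolynomial (Fin j) ℚ), j ≤ k ∧ F ∈ D j ∧ v = cubeVal j P F}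

/-- Auxiliary step `cubeVal_mem_VSpan`: cube Val mem VSpan. [bookkeeping] -/
theorem cubeVal_mem_VSpan {D : (k : ℕ) → Set (MvPolynomial (Fin k) ℚ)} {j k : ℕ} (hjk : j ≤ k)
    {F : MvPolynomial (Fin j) ℚ} (hF : F ∈ D j) (P : MvPolynomial (Fin j) ℚ) :
    cubeVal j P F ∈ VSpan D k :=
  Submodule.subset_span ⟨j, P, F, hjk, hF, rfl⟩

/-- Auxiliary step `value_mem_VSpan`: value mem VSpan. [bookkeeping] -/
theorem value_mem_VSpan {D : (k : ℕ) → Set (MvPolynomial (Fin k) ℚ)} {j k : ℕ} (hjk : j ≤ k)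
    (T : RFun j) (hT : T.den ∈ D j) : T.rep.value ∈ VSpan D k :=
  cubeVal_mem_VSpan hjk hT T.num

/-- Auxiliary step `VSpan_mono`: VSpan mono. [bookkeeping] -/
theorem VSpan_mono {D : (k : ℕ) → Set (MvPolynomial (Fin k) ℚ)} {j k : ℕ} (h : j ≤ k) :
    VSpan D j ≤ VSpan D k :=
  Submodule.span_mono fun _ ⟨i, P, F, hi, hF, hv⟩ => ⟨i, P, F, hi.trans h, hF, hv⟩

/-- **`D` is LETTER-GENERIC at level `k+1`** (over the levels `≤ k`): there are LETTERS
`T_i = num_i/den_i` (`i ∈ ι`, any index type; `den_i ∈ D (k+1)`) with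
(SPAN) for every `F ∈ D (k+1)` and every numerator `P`, `P − Σ_i c_i num_i ∈ Ex0m F` for a finitely
supported `c` living on `{i | den_i = F}` (exactness with simple poles along `F`, §9), and
(INDEP) `Σ_i c_i ∫T_i ∈ VSpan D k ⟹ c = 0` (the letter values are `ℚ`-linearly independent modulo every
value of dimension `≤ k` over `D`). (folklore) -/
def GenAt (D : (k : ℕ) → Set (MvPolynomial (Fin k) ℚ)) (k : ℕ) : Prop :=
  ∃ (ι : Type) (den num : ι → MvPolynomial (Fin (k + 1)) ℚ),
    (∀ i, den i ∈ D (k + 1)) ∧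
    (∀ F ∈ D (k + 1), ∀ P : MvPolynomial (Fin (k + 1)) ℚ, ∃ c : ι →₀ ℚ,
      (∀ i ∈ c.support, den i = F) ∧ P - c.sum (fun i r => C r * num i) ∈ Ex0m F) ∧
    (∀ c : ι →₀ ℚ, c.sum (fun i r => (r : ℝ) * cubeVal (k + 1) (num i) (den i)) ∈ VSpan D k → c = 0)

/-- **The family kernel at dimension `k` over `D`**: every finite family of cube representations of
dimension `k` with denominators in `D k` and total value `0` sums to an element of `KZ.relations`.
(cite KontsevichZagier2001, §1.2) -/
def FamilyKernel (D : (k : ℕ) → Set (MvPolynomial (Fin k) ℚ)) (k : ℕ) : Prop :=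
  ∀ (ι : Type) [Fintype ι] (t : ι → RFun k), (∀ a, (t a).den ∈ D k) →
    ∑ a, (t a).rep.value = 0 → ∑ a, KZ.of (t a).rep ∈ KZ.relations

/-! ### THEOREM U -/

/-- Merge of a finite family into ONE regular rational function (common denominator). (folklore) -/
def fmerge {ι : Type} [Fintype ι] (t : ι → RFun k) : RFun k :=
  lsum ((Finset.univ : Finset ι).toList.map t)

/-- `[merge] − Σ_a [t_a] ∈ relations`. (cite KontsevichZagier2001, §1.2 rule (1)) -/
theorem rel_fmerge {ι : Type} [Fintype ι] (t : ι → RFun k) :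
    KZ.of (fmerge t).rep - ∑ a, KZ.of (t a).rep ∈ KZ.relations := by
  have h := rel_lsum ((Finset.univ : Finset ι).toList.map t)
  rwa [List.map_map, Finset.sum_map_toList] at h

/-- **Base of THEOREM U** (dimensions `≤ 1`, NO letter hypothesis): merge and apply Baker-in-the-tree.
(cite KontsevichZagier2001, §1.2) -/
theorem familyKernel_of_le_one (D : (k : ℕ) → Set (MvPolynomial (Fin k) ℚ)) (hk : k ≤ 1) :
    FamilyKernel D k := by
  intro ι _ t _ h0
  have hU := rel_fmerge t
  have hval : (fmerge t).rep.value = 0 := by rw [value_eq_sum_of_rel _ _ _ hU, h0]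
  have hm := rep_mem_relations_of_dim_le_one hk (fmerge t) hval
  have : ∑ a, KZ.of (t a).rep = KZ.of (fmerge t).rep - (KZ.of (fmerge t).rep - ∑ a, KZ.of (t a).rep) := by
    abel
  rw [this]
  exact sub_mem hm hU

/-- **Step of THEOREM U**: genericity at level `k+2` carries the family kernel from dimension `k+1` to
dimension `k+2`. (cite KontsevichZagier2001, §1.2 rules (1),(3)) -/
theorem familyKernel_succ (D : (k : ℕ) → Set (MvPolynomial (Fin k) ℚ)) (hz : ZeroFree D)
    (hfc : FaceClosed D) (hG : GenAt D (k + 1)) (ih : FamilyKernel D (k + 1)) :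
    FamilyKernel D (k + 2) := by
  classical
  intro ι _ t ht h0
  obtain ⟨L, den, num, hden, hspan, hindep⟩ := hG
  choose c hc using fun a => hspan (t a).den (ht a) (t a).num
  -- the letters as representations, the exact parts, the potentials
  set ℓR : L → RFun (k + 2) := fun i => ⟨num i, den i, hz _ _ (hden i)⟩ with hℓR
  set E : ι → RFun (k + 2) :=
    fun a => ⟨(t a).num - (c a).sum (fun i r => C r * num i), (t a).den, (t a).den_ne⟩ with hE
  have hEmem : ∀ a, (E a).num ∈ Ex0m (E a).den := fun a => (hc a).2
  choose G hG using fun a => mem_ex0m_iff.mp (hEmem a)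
  set S : Finset L := Finset.univ.biUnion fun a => (c a).support with hS
  have hsub : ∀ a, (c a).support ⊆ S := fun a =>
    Finset.subset_biUnion_of_mem (fun a => (c a).support) (Finset.mem_univ a)
  -- (1) each member splits FORMALLY into its exact part and its letters
  have h1 : ∀ a, KZ.of (t a).rep - KZ.of (E a).rep - ∑ i ∈ S, KZ.of (smulNum (c a i) (ℓR i)).rep
      ∈ KZ.relations := by
    intro a
    set U : RFun (k + 2) := ⟨(c a).sum (fun i r => C r * num i), (t a).den, (t a).den_ne⟩ with hU
    have hA : KZ.of (t a).rep - KZ.of ((E a).add U).rep ∈ KZ.relations :=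
      RFun.rel_of_eqOn fun x hx => by
        rw [RFun.fn_add hx, RFun.fn_apply, RFun.fn_apply, RFun.fn_apply]
        show aeval x (t a).num / aeval x (t a).den
          = aeval x ((t a).num - (c a).sum (fun i r => C r * num i)) / aeval x (t a).den
            + aeval x ((c a).sum (fun i r => C r * num i)) / aeval x (t a).den
        rw [map_sub, sub_div, sub_add_cancel]
    have hB := RFun.rel_add (E a) U
    have hC : KZ.of U.rep - ∑ i ∈ S, KZ.of (smulNum (c a i) (ℓR i)).rep ∈ KZ.relations :=
      RFun.rel_sum S (fun i => smulNum (c a i) (ℓR i)) U fun x _ => by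
        rw [RFun.fn_apply]
        show aeval x ((c a).sum (fun i r => C r * num i)) / aeval x (t a).den
          = ∑ i ∈ S, (smulNum (c a i) (ℓR i)).fn x
        rw [Finsupp.sum, map_sum, Finset.sum_div,
          ← Finset.sum_subset (hsub a) (fun i _ hi => by
            rw [fn_smulNum, Finsupp.notMem_support_iff.1 hi, Rat.cast_zero, zero_mul])]
        refine Finset.sum_congr rfl fun i hi => ?_
        rw [fn_smulNum, RFun.fn_apply]
        show aeval x (C (c a i) * num i) / aeval x (t a).den
          = ((c a i : ℚ) : ℝ) * (aeval x (num i) / aeval x (den i))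
        rw [map_mul, MvPolynomial.aeval_C, eq_ratCast, (hc a).1 i hi, mul_div_assoc]
    have heq : KZ.of (t a).rep - KZ.of (E a).rep - ∑ i ∈ S, KZ.of (smulNum (c a i) (ℓR i)).rep
        = (KZ.of (t a).rep - KZ.of ((E a).add U).rep)
          + (KZ.of ((E a).add U).rep - KZ.of (E a).rep - KZ.of U.rep)
          + (KZ.of U.rep - ∑ i ∈ S, KZ.of (smulNum (c a i) (ℓR i)).rep) := by abel
    rw [heq]
    exact add_mem (add_mem hA hB) hC
  -- (2) values of the members
  have h2 : ∀ a, (t a).rep.value = (E a).rep.value + ∑ i ∈ S, ((c a i : ℚ) : ℝ) * (ℓR i).rep.value := by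
    intro a
    have h1' : KZ.of (t a).rep - (KZ.of (E a).rep + ∑ i ∈ S, KZ.of (smulNum (c a i) (ℓR i)).rep)
        ∈ KZ.relations := by
      have := h1 a
      rwa [sub_sub] at this
    have := eval_eq_of_sub_mem h1'
    rw [eval_of, map_add, map_sum, eval_of] at this
    rw [this]
    congr 1
    exact Finset.sum_congr rfl fun i _ => by rw [eval_of, value_smulNum]
  -- (3) the exact parts descend formally to the faces; their values lie in the lower span
  have h3 : ∀ a, KZ.of (E a).rep - ∑ p, KZ.of (faceFam (E a) (G a) p).rep ∈ KZ.relations :=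
    fun a => exact_rel_faceFam (E a) (G a) (hG a)
  have hfd : ∀ a p, (faceFam (E a) (G a) p).den ∈ D (k + 1) := by
    intro a p
    obtain ⟨c', hc', hd⟩ := faceFam_den (E a) (G a) p
    rw [hd]
    exact hfc _ _ (ht a) _ _ hc'
  have h3v : ∀ a, (E a).rep.value ∈ VSpan D (k + 1) := by
    intro a
    rw [value_eq_sum_of_rel _ _ _ (h3 a)]
    exact sum_mem fun p _ => value_mem_VSpan le_rfl _ (hfd a p)
  -- (4) the total value: INDEP kills every total letter coefficient
  have htot : ∑ a, (t a).rep.value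
      = ∑ a, (E a).rep.value + ∑ i ∈ S, ((∑ a, c a i : ℚ) : ℝ) * (ℓR i).rep.value := by
    rw [Finset.sum_congr rfl fun a _ => h2 a, Finset.sum_add_distrib]
    congr 1
    rw [Finset.sum_comm]
    refine Finset.sum_congr rfl fun i _ => ?_
    rw [Rat.cast_sum, Finset.sum_mul]
  rw [h0] at htot
  set Ctot : L →₀ ℚ := ∑ a, c a with hCtot
  have hCsupp : Ctot.support ⊆ S := Finsupp.support_finsetSum
  have hCapp : ∀ i, Ctot i = ∑ a, c a i := fun i => by rw [hCtot, Finsupp.finsetSum_apply]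
  have hCsum : Ctot.sum (fun i r => (r : ℝ) * cubeVal (k + 1 + 1) (num i) (den i))
      = ∑ i ∈ S, ((∑ a, c a i : ℚ) : ℝ) * (ℓR i).rep.value := by
    rw [Finsupp.sum_of_support_subset Ctot hCsupp _ (fun i _ => by rw [Rat.cast_zero, zero_mul])]
    exact Finset.sum_congr rfl fun i _ => by rw [hCapp]; rfl
  have hmem : Ctot.sum (fun i r => (r : ℝ) * cubeVal (k + 1 + 1) (num i) (den i)) ∈ VSpan D (k + 1) := by
    rw [hCsum, show ∑ i ∈ S, ((∑ a, c a i : ℚ) : ℝ) * (ℓR i).rep.value = -∑ a, (E a).rep.value by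
      linarith]
    exact neg_mem (sum_mem fun a _ => h3v a)
  have hC0 : Ctot = 0 := hindep Ctot hmem
  have hci : ∀ i, (∑ a, c a i) = 0 := fun i => by rw [← hCapp, hC0, Finsupp.zero_apply]
  -- (5) the letter representations cancel FORMALLY (rule 1), letter by letter
  have h5 : ∑ a, ∑ i ∈ S, KZ.of (smulNum (c a i) (ℓR i)).rep ∈ KZ.relations := by
    rw [Finset.sum_comm]
    refine sum_mem fun i _ => ?_
    have hZ : KZ.of (smulNum 0 (ℓR i)).rep ∈ KZ.relations :=
      RFun.rel_of_eqOn_zero fun x _ => by rw [fn_smulNum, Rat.cast_zero, zero_mul]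
    have hM : KZ.of (smulNum 0 (ℓR i)).rep - ∑ a, KZ.of (smulNum (c a i) (ℓR i)).rep ∈ KZ.relations :=
      RFun.rel_sum Finset.univ (fun a => smulNum (c a i) (ℓR i)) _ fun x _ => by
        simp only [fn_smulNum]
        rw [← Finset.sum_mul, ← Rat.cast_sum, hci i]
    have : ∑ a, KZ.of (smulNum (c a i) (ℓR i)).rep = KZ.of (smulNum 0 (ℓR i)).rep
        - (KZ.of (smulNum 0 (ℓR i)).rep - ∑ a, KZ.of (smulNum (c a i) (ℓR i)).rep) := by abel
    rw [this]
    exact sub_mem hZ hM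
  -- (6) the face family, one dimension down, has total value 0: induction
  have hEsum : ∑ a, (E a).rep.value = 0 := by
    simp only [hci, Rat.cast_zero, zero_mul, Finset.sum_const_zero, add_zero] at htot
    exact htot.symm
  set t' : ι × (Fin (k + 2) × Bool) → RFun (k + 1) := fun ap => faceFam (E ap.1) (G ap.1) ap.2 with ht'
  have ht'd : ∀ ap, (t' ap).den ∈ D (k + 1) := fun ap => hfd ap.1 ap.2
  have ht'0 : ∑ ap, (t' ap).rep.value = 0 := by
    rw [Fintype.sum_prod_type, ← hEsum]
    exact Finset.sum_congr rfl fun a _ => (value_eq_sum_of_rel _ _ _ (h3 a)).symm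
  have hIH := ih (ι × (Fin (k + 2) × Bool)) t' ht'd ht'0
  rw [Fintype.sum_prod_type] at hIH
  have hEs : ∑ a, KZ.of (E a).rep ∈ KZ.relations := by
    have : ∑ a, KZ.of (E a).rep = ∑ a, (KZ.of (E a).rep - ∑ p, KZ.of (faceFam (E a) (G a) p).rep)
        + ∑ a, ∑ p, KZ.of (faceFam (E a) (G a) p).rep := by
      rw [← Finset.sum_add_distrib]
      exact Finset.sum_congr rfl fun a _ => by abel
    rw [this]
    exact add_mem (sum_mem fun a _ => h3 a) hIH
  -- (7) assemble
  have : ∑ a, KZ.of (t a).rep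
      = ∑ a, (KZ.of (t a).rep - KZ.of (E a).rep - ∑ i ∈ S, KZ.of (smulNum (c a i) (ℓR i)).rep)
        + ∑ a, KZ.of (E a).rep + ∑ a, ∑ i ∈ S, KZ.of (smulNum (c a i) (ℓR i)).rep := by
    rw [← Finset.sum_add_distrib, ← Finset.sum_add_distrib]
    exact Finset.sum_congr rfl fun a _ => by abel
  rw [this]
  exact add_mem (add_mem (sum_mem fun a _ => h1 a) hEs) h5

/-- **THEOREM U.** A zero-free, face-closed denominator system that is letter-generic at the levels
`2 … m` has the family kernel in every dimension `k ≤ m` (`N = 0`). (cite KontsevichZagier2001, §1.2) -/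
theorem familyKernel_of_generic (D : (k : ℕ) → Set (MvPolynomial (Fin k) ℚ)) (hz : ZeroFree D)
    (hfc : FaceClosed D) (m : ℕ) (hgen : ∀ k, k + 2 ≤ m → GenAt D (k + 1)) :
    ∀ k, k ≤ m → FamilyKernel D k
  | 0, _ => familyKernel_of_le_one D (Nat.zero_le 1)
  | 1, _ => familyKernel_of_le_one D le_rfl
  | k + 2, hk => familyKernel_succ D hz hfc (hgen k hk)
      (familyKernel_of_generic D hz hfc m hgen (k + 1) (Nat.le_of_succ_le hk))

/-- **THEOREM U for one representation**: `[ [0,1]^m, P/Q ]` of value `0` with `Q ∈ D m`, `D` generic at the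
levels `2 … m`, is `≡ 0` — for EVERY numerator `P`. (cite KontsevichZagier2001, §1.2) -/
theorem rep_mem_relations_of_generic (D : (k : ℕ) → Set (MvPolynomial (Fin k) ℚ)) (hz : ZeroFree D)
    (hfc : FaceClosed D) {m : ℕ} (hgen : ∀ k, k + 2 ≤ m → GenAt D (k + 1)) (T : RFun m)
    (hT : T.den ∈ D m) (h0 : T.rep.value = 0) : KZ.of T.rep ∈ KZ.relations := by
  have h := familyKernel_of_generic D hz hfc m hgen m le_rfl (Fin 1) (fun _ => T) (fun _ => hT)
    (by rw [Fin.sum_univ_one]; exact h0)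
  rwa [Fin.sum_univ_one] at h

/-! ### The node: `26322 ⟸ GenericKernel (THEOREM) ∧ SpecialKernel (typed residual)` -/

/-- **`Q` is LETTER-GENERIC**: `Q` belongs to a zero-free, face-closed denominator system that is
letter-generic at every level `2 … m`. (folklore) -/
def IsGeneric {m : ℕ} (Q : MvPolynomial (Fin m) ℚ) : Prop :=
  ∃ D : (k : ℕ) → Set (MvPolynomial (Fin k) ℚ),
    ZeroFree D ∧ FaceClosed D ∧ Q ∈ D m ∧ ∀ k, k + 2 ≤ m → GenAt D (k + 1)

/-- **GENERIC PIECE `GenericKernel`** := crux 26322 `RationalCubePiKernelSingle` restricted to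
letter-generic denominators (verbatim binders plus `IsGeneric Q`). A THEOREM (`genericKernel_holds`).
(cite KontsevichZagier2001, §1.2) -/
def GenericKernel : Prop :=
  ∀ (m : ℕ) (q : IntegralRep m) (P Q : MvPolynomial (Fin m) ℚ), IsGeneric Q →
    q.domain = Set.pi Set.univ (fun _ : Fin m => Set.Icc (0:ℝ) 1) →
    (∀ z ∈ Set.pi Set.univ (fun _ : Fin m => Set.Icc (0:ℝ) 1), MvPolynomial.aeval z Q ≠ 0) →
    (∀ z ∈ Set.pi Set.univ (fun _ : Fin m => Set.Icc (0:ℝ) 1),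
      q.integrand z = MvPolynomial.aeval z P / MvPolynomial.aeval z Q) →
    q.value = 0 → ∃ N : ℕ, (fun y : FormalRep => of piRep * y)^[N] (of q) ∈ relations

/-- **SPECIAL PIECE `SpecialKernel` (the typed residual)** := crux 26322 restricted to the denominators
that are NOT letter-generic: every zero-free face-closed system through `Q` carries, at some level
`2 … m`, a genuine `ℚ`-linear relation among its letters modulo the lower values (or fails SPAN).
(cite KontsevichZagier2001, §1.2) -/
def SpecialKernel : Prop :=
  ∀ (m : ℕ) (q : IntegralRep m) (P Q : MvPolynomial (Fin m) ℚ), ¬ IsGeneric Q →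
    q.domain = Set.pi Set.univ (fun _ : Fin m => Set.Icc (0:ℝ) 1) →
    (∀ z ∈ Set.pi Set.univ (fun _ : Fin m => Set.Icc (0:ℝ) 1), MvPolynomial.aeval z Q ≠ 0) →
    (∀ z ∈ Set.pi Set.univ (fun _ : Fin m => Set.Icc (0:ℝ) 1),
      q.integrand z = MvPolynomial.aeval z P / MvPolynomial.aeval z Q) →
    q.value = 0 → ∃ N : ℕ, (fun y : FormalRep => of piRep * y)^[N] (of q) ∈ relations

end LetterCriterion
end Summit.KontsevichZagierPeriods.RootDecompRationalCubeDichotomy.Rung26322.RankDescent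
end
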